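import Summits.FinalStateConjecture.FinalStateConjecture.Theorems.BartnikGapSettlingBondiBartnikRigidityRouteMarchingDefs
import Summits.FinalStateConjecture.FinalStateConjecture.Theorems.BartnikGapSettlingBondiBartnikRigiditySlabFrontierCausalClocks
import Summits.FinalStateConjecture.FinalStateConjecture.Theorems.BartnikGapSettlingBondiBartnikRigiditySlabFrontierLens
import Literature.Geometry.Lorentzian.CausalityPushUp
import Literature.Geometry.Lorentzian.KerrRedShiftCoercivity
import HarnessLib

/-!
# K2b-2 `SlabFrontier` (stub `stub_slabFrontier`) — line `direct-method-on-the-cone`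
# (crux `BondiBartnikRigidity`, stmt-FinalStateConjecture-10807)

In the Kerr star chart `Kerr.spacetime M a M` (`{r > M}`, ingoing Kerr–Schild coordinates, `0 < M`,
`|a| < M`) the frontier of the causal future of the thick slab `slabK = {t* = 0, r ≤ 3M}` off the slab
is ruled from the outer edge sphere `S₃ = {t* = 0, r = 3M}`:
`frontier J⁺(slab) ⊆ slab ∪ J⁺(S₃)` — the route statement `K2Route.SlabFrontier`, given
`K2Route.SlabFutureContainsCylinder` (the registered signature `stub_slabFrontier`).

Proof.  Let `x ∈ ∂J⁺(slab)`, so `x ∈ closure J⁺(slab) ∖ interior J⁺(slab)`.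
1. `J⁺(slab) ⊆ {t* ≥ 0} ∩ {2r ≤ 6M + 3t*}` (a closed set): `t*` and `t* − (2/3) r` increase along
   future causal curves (`KerrCausal.strictMonoOn_time`, `KerrCausal.strictMonoOn_clock`).  Hence
   `t*(x) ≥ 0`, and `t*(x) = 0` forces `r(x) ≤ 3M`, i.e. `x ∈ slab`.
2. If `t*(x) > 0` then `r(x) ≥ 3M`: the open cylinder `{t* > 0, r < 3M}` lies in `J⁺(slab)`
   (hypothesis), hence in its interior.
3. `t*(x) > 0`, `r(x) ≥ 3M` ⟹ `x ∈ J⁺(slab)` (CLOSEDNESS): split `slab = slab₀ ∪ slab₁`,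
   `slab₀ = slab ∩ {r < r₊}`, `slab₁ = slab ∩ {r ≥ r₁}` (`M < r₁ < r₊ ≤ 2M`), `slab₁` compact.
   `J⁺(slab₀) ⊆ {r < r₊}` by the integrated hole clock (`KerrCausal.radius_le_of_radius_lt_rPlus`), so
   `x ∈ closure J⁺(slab₁)`.  The big lens `U_A = {3A − 2r ∓ 3t* > 0} ∩ {2t* + r − M > 0}`,
   `A = t*(x) + r(x) + 1`, contains `x` and `slab`, is globally hyperbolic
   (`KerrLens.isGloballyHyperbolic_lens`), so `J⁺_{U_A}(slab₁)` is closed in `U_A`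
   (`KerrLens.isClosed_causalFuture_lens`); every causal curve of the chart from `slab₁` to a point of
   `U_A` stays in `U_A` (the three lens functions are monotone along it), so
   `J⁺(slab₁) ∩ U_A = J⁺_{U_A}(slab₁)` and `x ∈ J⁺(slab₁)`.
4. A causal curve `γ` from `p ∈ slab₁` to `x` has `t* > 0` after its start; if it met `{r < 3M}` there
   it would enter `I⁺(slab)` (`interior J⁺ ⊆ I⁺`, `interior_causalFuture_subset`) and push-up
   (`J⁺ ∘ I⁺ ⊆ I⁺`, open) would put `x` in the interior.  So `r ≥ 3M` along `γ` after the start, and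
   by continuity `r(p) = 3M`: `p ∈ S₃`, `x ∈ J⁺(S₃)`.

References: Hawking–Ellis 1973, §6.3, Prop. 6.3.1, §6.6, Prop. 6.6.1 [HawkingEllis1973CUP]; O'Neill
1983, Ch. 14, Cor. 14.1, Lemma 14.6, Lemma 14.22, Cor. 14.39 [ONeill1983]; Dafermos–Rodnianski
arXiv:0811.0354, §5.1 [DafermosRodnianski2008].  No definitions, no named facts.
-/

noncomputable section

-- D-0017: single-problem summit, `Summit.<S>.<S>.…` by design (cf. lakefile `weak.linter.dupNamespace`).
set_option linter.dupNamespace false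
-- instance search through the nested operator types of the Kerr chart facts
set_option maxSynthPendingDepth 3

open Set Filter Function Topology TopologicalSpace
open Literature.Geometry.Lorentzian
open scoped Manifold ContDiff Topology

namespace Summit.FinalStateConjecture.FinalStateConjecture.Theorems.BondiBartnikRigidity.DirectMethod

namespace FrontierK

open SubCausal
open Summit.FinalStateConjecture.FinalStateConjecture.Theorems.ZeroEnergyRigidity.GlobalHorizonKillingField.FuturePresentation
  (image_val_causalFuture_restrict_subset)

/-! ### The Kerr side: a priori bounds on `J⁺(slab)` and the frontier -/

section KerrSide

variable [Kerr.Facts] {M a : ℝ}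

/-- `J⁺_K` of the bundled star spacetime is the causal future of the smooth Kerr metric with the
orientation `−g♯dt*` (by `rfl`; used to move between the two spellings). [folklore] -/
theorem JK_eq (hM : 0 < M) (S : Set (Kerr.region a M)) :
    JK M a hM S = (Kerr.smoothMetric M a M).causalFuture ((Kerr.timeOrientation M a M hM.le).ofLE le_top) S :=
  rfl

/-- **`J⁺(slab) ⊆ {t* ≥ 0} ∩ {2r ≤ 6M + 3t*}`**: `t*` and the clock `t* − (2/3) r` are increasing along
future causal curves of the chart (`KerrCausal.strictMonoOn_time`, `KerrCausal.strictMonoOn_clock`),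
and on the slab `t* = 0`, `r ≤ 3M`. [cite: DafermosRodnianski2008, §5.1] -/
theorem JK_slabK_subset (hM : 0 < M) (ha : |a| < M) :
    (Kerr.smoothMetric M a M).causalFuture ((Kerr.timeOrientation M a M hM.le).ofLE le_top) (slabK M a) ⊆
      {y | 0 ≤ y.1 0 ∧ 2 * Kerr.radius a y.1 ≤ 6 * M + 3 * y.1 0} := by
  rintro y (⟨hy0, hyr⟩ | ⟨p, ⟨hp0, hpr⟩, γ, b₀, b₁, hb, hγ, hpa, hyb⟩)
  · have hy0' : (y : E4) 0 = 0 := hy0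
    have hyr' : Kerr.radius a (y : E4) ≤ 3 * M := hyr
    exact ⟨hy0'.ge, by show 2 * Kerr.radius a (y : E4) ≤ 6 * M + 3 * (y : E4) 0; linarith⟩
  · have h0 := KerrCausal.strictMonoOn_time ordConnected_Icc hγ (left_mem_Icc.2 hb.le)
      (right_mem_Icc.2 hb.le) hb
    have h1 := (KerrCausal.strictMonoOn_clock (c := -(2 / 3))
      (by rw [abs_neg, abs_of_pos (by norm_num)]) ha ordConnected_Icc hγ).monotoneOn
      (left_mem_Icc.2 hb.le) (right_mem_Icc.2 hb.le) hb.le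
    simp only [hpa, hyb] at h0 h1
    have hp0' : (p : E4) 0 = 0 := hp0
    have hpr' : Kerr.radius a (p : E4) ≤ 3 * M := hpr
    exact ⟨by show 0 ≤ (y : E4) 0; linarith,
      by show 2 * Kerr.radius a (y : E4) ≤ 6 * M + 3 * (y : E4) 0; linarith⟩

/-- The a priori region `{t* ≥ 0} ∩ {2r ≤ 6M + 3t*}` is closed, hence contains `closure J⁺(slab)`.
[folklore] -/
theorem closure_JK_slabK_subset (hM : 0 < M) (ha : |a| < M) :
    closure ((Kerr.smoothMetric M a M).causalFuture ((Kerr.timeOrientation M a M hM.le).ofLE le_top)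
      (slabK M a)) ⊆ {y | 0 ≤ y.1 0 ∧ 2 * Kerr.radius a y.1 ≤ 6 * M + 3 * y.1 0} := by
  refine closure_minimal (JK_slabK_subset hM ha) ?_
  have h0 := K2Route.continuous_tstar a M
  have hr := K2Route.continuous_radius_region a M
  have h1 : Continuous fun y : Kerr.region a M => 2 * Kerr.radius a y.1 := by fun_prop
  have h2 : Continuous fun y : Kerr.region a M => 6 * M + 3 * y.1 0 := by fun_prop
  exact (isClosed_le continuous_const h0).and (isClosed_le h1 h2)

/-- **`J⁺` of the part of the slab inside the black hole stays inside**: `J⁺(slab ∩ {r < r₊}) ⊆ {r < r₊}`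
(integrated hole clock `KerrCausal.radius_le_of_radius_lt_rPlus`). [cite: ONeill1995, Ch. 2] -/
theorem JK_slabK_hole_subset (hM : 0 < M) (ha : |a| < M) :
    (Kerr.smoothMetric M a M).causalFuture ((Kerr.timeOrientation M a M hM.le).ofLE le_top)
        (slabK M a ∩ {y | Kerr.radius a y.1 < Kerr.rPlus M a}) ⊆
      {y | Kerr.radius a y.1 < Kerr.rPlus M a} := by
  rintro y (⟨-, hy⟩ | ⟨p, ⟨-, hp⟩, γ, b₀, b₁, hb, hγ, hpa, hyb⟩)
  · exact hy
  · have hp' : Kerr.radius a (γ b₀ : E4) < Kerr.rPlus M a := by rw [hpa]; exact hp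
    have h := KerrCausal.radius_le_of_radius_lt_rPlus ha hγ hp' b₁ (right_mem_Icc.2 hb.le)
    rw [hyb] at h
    exact lt_of_le_of_lt h hp'

/-- **Closedness step**: a point `x` of `closure J⁺(slab₁)`, `slab₁ = slab ∩ {r ≥ r₁}` (`M < r₁`), lying in
the big lens `U_A` (`2M < A`, so that `slab ⊆ U_A`) belongs to `J⁺(slab₁)`: `U_A` is globally hyperbolic,
so `J⁺_{U_A}` of the compact `slab₁` is closed in `U_A` (`KerrLens.isClosed_causalFuture_lens`), and no
causal curve of the chart from `slab₁` to a point of `U_A` leaves `U_A` (the lens functions are monotone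
along it, `KerrCausal.strictMonoOn_clock`), so that `J⁺(slab₁) ∩ U_A = J⁺_{U_A}(slab₁)`.
[cite: HawkingEllis1973CUP, §6.6, Prop. 6.6.1] -/
theorem mem_JK_of_mem_closure (hM : 0 < M) (ha : |a| < M) {r₁ A : ℝ} (hr₁ : M < r₁) (hA : 2 * M < A)
    {x : Kerr.region a M}
    (hx : x ∈ closure ((Kerr.smoothMetric M a M).causalFuture
      ((Kerr.timeOrientation M a M hM.le).ofLE le_top) (slabK M a ∩ {y | r₁ ≤ Kerr.radius a y.1})))
    (hxU : 0 < 3 * A - 2 * Kerr.radius a x.1 - 3 * x.1 0 ∧ 0 < 3 * A - 2 * Kerr.radius a x.1 + 3 * x.1 0 ∧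
      0 < 2 * x.1 0 + (Kerr.radius a x.1 - M)) :
    x ∈ (Kerr.smoothMetric M a M).causalFuture ((Kerr.timeOrientation M a M hM.le).ofLE le_top)
      (slabK M a ∩ {y | r₁ ≤ Kerr.radius a y.1}) := by
  -- the lens `U_A` as an open set of the chart, with its membership predicate
  have h0 := K2Route.continuous_tstar a M
  have hr := K2Route.continuous_radius_region a M
  have hc1 : Continuous fun y : Kerr.region a M => 3 * A - 2 * Kerr.radius a y.1 - 3 * y.1 0 := by
    fun_prop
  have hc2 : Continuous fun y : Kerr.region a M => 3 * A - 2 * Kerr.radius a y.1 + 3 * y.1 0 := by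
    fun_prop
  have hc3 : Continuous fun y : Kerr.region a M => 2 * y.1 0 + (Kerr.radius a y.1 - M) := by fun_prop
  have hUo : IsOpen {y : Kerr.region a M | 0 < 3 * A - 2 * Kerr.radius a y.1 - 3 * y.1 0 ∧
      0 < 3 * A - 2 * Kerr.radius a y.1 + 3 * y.1 0 ∧ 0 < 2 * y.1 0 + (Kerr.radius a y.1 - M)} :=
    (isOpen_lt continuous_const hc1).and
      ((isOpen_lt continuous_const hc2).and (isOpen_lt continuous_const hc3))
  set U : Opens (Kerr.spacetime M a M hM.le).carrier := ⟨_, hUo⟩ with hUeq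
  have hU : ∀ y : Kerr.region a M, y ∈ U ↔ 0 < 3 * A - 2 * Kerr.radius a y.1 - 3 * y.1 0 ∧
      0 < 3 * A - 2 * Kerr.radius a y.1 + 3 * y.1 0 ∧ 0 < 2 * y.1 0 + (Kerr.radius a y.1 - M) :=
    fun y => Iff.rfl
  set g := (Kerr.spacetime M a M hM.le).metric with hg
  set τ := (Kerr.spacetime M a M hM.le).timeOrientation with hτ
  set slab₁ : Set (Kerr.region a M) := slabK M a ∩ {y | r₁ ≤ Kerr.radius a y.1} with hslab₁
  -- `slab₁ ⊆ U`
  have hslabU : ∀ y, y ∈ slab₁ → y ∈ U := by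
    rintro y ⟨⟨hy0, hyr⟩, -⟩
    have hyM : M < Kerr.radius a y.1 := Kerr.lt_radius_of_mem_region y.2
    have hy0' : (y : E4) 0 = 0 := hy0
    have hyr' : Kerr.radius a (y : E4) ≤ 3 * M := hyr
    refine (hU y).2 ⟨?_, ?_, ?_⟩ <;> linarith
  -- `slab₁` is compact (closed and bounded in `E4`, inside the chart)
  have hc : IsCompact slab₁ := by
    have hK := Kerr.isCompact_timeZero_radius_slab a (r₁ := (r₁ + 3 * M) / 2) (η₀ := (3 * M - r₁) / 2)
      (by linarith)
    have hsub : {x : E4 | x 0 = 0 ∧ |Kerr.radius a x - (r₁ + 3 * M) / 2| ≤ (3 * M - r₁) / 2} ⊆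
        range (Subtype.val : Kerr.region a M → E4) := by
      rintro z ⟨-, hz⟩
      have := (abs_le.1 hz).1
      exact ⟨⟨z, by rw [Kerr.mem_region, max_eq_left hM.le]; linarith⟩, rfl⟩
    have heq : slab₁ = Subtype.val ⁻¹'
        {x : E4 | x 0 = 0 ∧ |Kerr.radius a x - (r₁ + 3 * M) / 2| ≤ (3 * M - r₁) / 2} := by
      ext y
      simp only [hslab₁, slabK, mem_inter_iff, mem_setOf_eq, mem_preimage, abs_le]
      constructor
      · rintro ⟨⟨h1, h2⟩, h3⟩; exact ⟨h1, by linarith, by linarith⟩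
      · rintro ⟨h1, h2, h3⟩; exact ⟨⟨h1, by linarith⟩, by linarith⟩
    rw [heq, Topology.IsEmbedding.subtypeVal.isCompact_iff, image_preimage_eq_of_subset hsub]
    exact hK
  set K : Set U := Subtype.val ⁻¹' slab₁ with hK
  have hKsub : slab₁ ⊆ range (Subtype.val : U → (Kerr.spacetime M a M hM.le).carrier) :=
    fun y hy => ⟨⟨y, hslabU y hy⟩, rfl⟩
  have hKc : IsCompact K := (Topology.IsInducing.subtypeVal.isCompact_preimage_iff hKsub).2 hc
  have hKval : Subtype.val '' K = slab₁ := image_preimage_eq_of_subset hKsub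
  -- `J⁺_U(K)` is closed in `U`
  have hJc := KerrLens.isClosed_causalFuture_lens A hM ha U hU hKc
  -- every chart-causal curve from `slab₁` to a point of `U` stays in `U`, so `ι⁻¹ J⁺(slab₁) ⊆ J⁺_U(K)`
  have hin : ∀ (y : Kerr.region a M) (hyU : y ∈ U), y ∈ (Kerr.smoothMetric M a M).causalFuture
      ((Kerr.timeOrientation M a M hM.le).ofLE le_top) slab₁ →
      (⟨y, hyU⟩ : U) ∈ (g.restrict PseudoRiemannianMetric.contMDiff_restrict_holds U).causalFuture
        (τ.restrict PseudoRiemannianMetric.contMDiff_restrict_holds τ.contMDiff_restrict_holds U) K := by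
    intro y hyU hy
    rcases hy with hy | ⟨p, hp, γ, b₀, b₁, hb, hγ, hpa, hyb⟩
    · exact Or.inl hy
    · have hpU := (hU p).1 (hslabU p hp)
      have hyU' := (hU y).1 hyU
      have hstay : ∀ t ∈ Icc b₀ b₁, γ t ∈ U := by
        intro t ht
        have h1 := (KerrCausal.strictMonoOn_clock (c := 2 / 3) (by rw [abs_of_pos (by norm_num)]) ha
          ordConnected_Icc hγ).monotoneOn ht (right_mem_Icc.2 hb.le) ht.2
        have h2 := (KerrCausal.strictMonoOn_clock (c := -(2 / 3))
          (by rw [abs_neg, abs_of_pos (by norm_num)]) ha ordConnected_Icc hγ).monotoneOn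
          (left_mem_Icc.2 hb.le) ht ht.1
        have h3 := (KerrCausal.strictMonoOn_clock (c := 1 / 2)
          (by rw [abs_of_pos (by norm_num)]; norm_num) ha ordConnected_Icc hγ).monotoneOn
          (left_mem_Icc.2 hb.le) ht ht.1
        simp only [hpa, hyb] at h1 h2 h3
        refine (hU (γ t)).2 ⟨?_, ?_, ?_⟩
        · linarith [hyU'.1]
        · linarith [hpU.2.1]
        · linarith [hpU.2.2]
      obtain ⟨hbU, hmem⟩ := mem_causalFuture_restrict_of_subset g τ
        PseudoRiemannianMetric.contMDiff_restrict_holds τ.contMDiff_restrict_holds U hb hγ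
        (by rw [hKval, hpa]; exact hp) hstay
      have : (⟨y, hyU⟩ : U) = ⟨γ b₁, hbU⟩ := Subtype.ext hyb.symm
      rw [this]
      exact hmem
  -- conclude: `x ∈ closure_U (ι⁻¹ J⁺(slab₁)) ⊆ J⁺_U(K) ⊆ ι⁻¹ J⁺(slab₁)`
  have hxU' : x ∈ U := (hU x).2 hxU
  have hcl : (⟨x, hxU'⟩ : U) ∈ closure (Subtype.val ⁻¹' ((Kerr.smoothMetric M a M).causalFuture
      ((Kerr.timeOrientation M a M hM.le).ofLE le_top) slab₁) : Set U) :=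
    (U.2.isOpenMap_subtype_val).preimage_closure_subset_closure_preimage hx
  have hxJU : (⟨x, hxU'⟩ : U) ∈ (g.restrict PseudoRiemannianMetric.contMDiff_restrict_holds U).causalFuture
      (τ.restrict PseudoRiemannianMetric.contMDiff_restrict_holds τ.contMDiff_restrict_holds U) K :=
    hJc.closure_subset (closure_mono (fun z hz => hin z.1 z.2 hz) hcl)
  have hout := image_val_causalFuture_restrict_subset g τ PseudoRiemannianMetric.contMDiff_restrict_holds
    τ.contMDiff_restrict_holds U K ⟨_, hxJU, rfl⟩
  rw [hKval] at hout
  exact hout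

/-- **The frontier of `J⁺(slab)` off the slab is ruled from `S₃`** (set form of `K2Route.SlabFrontier`
given the solid cylinder `{t* ≥ 0, r ≤ 3M} ⊆ J⁺(slab)`): steps 1–4 of the module docstring.
[cite: HawkingEllis1973CUP, §6.3, Prop. 6.3.1] -/
theorem frontier_JK_slabK_subset (hM : 0 < M) (ha : |a| < M)
    (hcyl : {y : Kerr.region a M | 0 ≤ y.1 0 ∧ Kerr.radius a y.1 ≤ 3 * M} ⊆ JK M a hM (slabK M a)) :
    frontier (JK M a hM (slabK M a)) ⊆ slabK M a ∪ JK M a hM (outerSphereK M a) := by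
  simp only [JK_eq] at hcyl ⊢
  intro x hx
  have hn1 : (1 : ℕ∞ω) ≤ ∞ := by exact_mod_cast le_top
  have h0c := K2Route.continuous_tstar a M
  have hrc := K2Route.continuous_radius_region a M
  obtain ⟨hx0, hxr⟩ := closure_JK_slabK_subset hM ha (frontier_subset_closure hx)
  have hxint : x ∉ interior ((Kerr.smoothMetric M a M).causalFuture
      ((Kerr.timeOrientation M a M hM.le).ofLE le_top) (slabK M a)) := fun h => hx.2 h
  -- the open cylinder `{t* > 0, r < 3M}` lies in the interior of `J⁺(slab)`
  have hcylint : {y : Kerr.region a M | 0 < y.1 0 ∧ Kerr.radius a y.1 < 3 * M} ⊆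
      interior ((Kerr.smoothMetric M a M).causalFuture
        ((Kerr.timeOrientation M a M hM.le).ofLE le_top) (slabK M a)) :=
    interior_maximal (fun y hy => hcyl ⟨hy.1.le, hy.2.le⟩)
      ((isOpen_lt continuous_const h0c).and (isOpen_lt hrc continuous_const))
  rcases hx0.eq_or_lt with hx0 | hx0
  · -- `t*(x) = 0`: `r(x) ≤ 3M`, `x ∈ slab`
    refine Or.inl ⟨hx0.symm, ?_⟩
    show Kerr.radius a (x : E4) ≤ 3 * M
    rw [← hx0] at hxr
    linarith
  right
  have hxr3 : 3 * M ≤ Kerr.radius a x.1 := by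
    by_contra h
    push Not at h
    exact hxint (hcylint ⟨hx0, h⟩)
  -- step 3: `x ∈ J⁺(slab₁)`, `slab₁ = slab ∩ {r ≥ r₁}`, `r₁ = (M + r₊)/2`
  have hrp1 : M < Kerr.rPlus M a := F1Route.self_lt_rPlus ha
  have hrp2 : Kerr.rPlus M a ≤ 2 * M := Kerr.rPlus_le_two_mul hM.le
  set r₁ : ℝ := (M + Kerr.rPlus M a) / 2 with hr₁
  have hsplit : slabK M a ⊆ (slabK M a ∩ {y | Kerr.radius a y.1 < Kerr.rPlus M a}) ∪
      (slabK M a ∩ {y | r₁ ≤ Kerr.radius a y.1}) := by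
    intro y hy
    rcases lt_or_ge (Kerr.radius a y.1) (Kerr.rPlus M a) with h | h
    · exact Or.inl ⟨hy, h⟩
    · exact Or.inr ⟨hy, by show (M + Kerr.rPlus M a) / 2 ≤ _; linarith⟩
  have hJsplit : (Kerr.smoothMetric M a M).causalFuture ((Kerr.timeOrientation M a M hM.le).ofLE le_top)
        (slabK M a) ⊆
      (Kerr.smoothMetric M a M).causalFuture ((Kerr.timeOrientation M a M hM.le).ofLE le_top)
          (slabK M a ∩ {y | Kerr.radius a y.1 < Kerr.rPlus M a}) ∪
        (Kerr.smoothMetric M a M).causalFuture ((Kerr.timeOrientation M a M hM.le).ofLE le_top)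
          (slabK M a ∩ {y | r₁ ≤ Kerr.radius a y.1}) := by
    intro y hy
    rw [LorentzianMetric.causalFuture_eq_biUnion] at hy
    simp only [mem_iUnion, exists_prop] at hy
    obtain ⟨p, hp, hyp⟩ := hy
    rcases hsplit hp with hp' | hp'
    · exact Or.inl (LorentzianMetric.causalFuture_mono (singleton_subset_iff.2 hp') hyp)
    · exact Or.inr (LorentzianMetric.causalFuture_mono (singleton_subset_iff.2 hp') hyp)
  have hx1 : x ∈ closure ((Kerr.smoothMetric M a M).causalFuture
      ((Kerr.timeOrientation M a M hM.le).ofLE le_top) (slabK M a ∩ {y | r₁ ≤ Kerr.radius a y.1})) := by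
    have h := closure_mono hJsplit (frontier_subset_closure hx)
    rw [closure_union] at h
    rcases h with h | h
    · exfalso
      have h' := closure_minimal ((JK_slabK_hole_subset hM ha).trans fun y hy => le_of_lt hy)
        (isClosed_le hrc continuous_const) h
      have : Kerr.radius a x.1 ≤ Kerr.rPlus M a := h'
      linarith
    · exact h
  set A : ℝ := x.1 0 + Kerr.radius a x.1 + 1 with hA
  have hxJ := mem_JK_of_mem_closure hM ha (r₁ := r₁) (A := A) (by rw [hr₁]; linarith)
    (by rw [hA]; linarith) hx1 ⟨by rw [hA]; linarith, by rw [hA]; linarith, by linarith⟩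
  -- step 4: a causal curve from `p ∈ slab₁` to `x` starts on `S₃`
  rcases hxJ with ⟨⟨hx00, -⟩, -⟩ | ⟨p, ⟨⟨hp0, hpr⟩, -⟩, γ, b₀, b₁, hb, hγ, hpa, hxb⟩
  · exfalso
    have : (x : E4) 0 = 0 := hx00
    linarith
  have hp0' : (γ b₀ : E4) 0 = 0 := by rw [hpa]; exact hp0
  -- `r ≥ 3M` along `γ` after the start
  have hfar : ∀ t ∈ Ioc b₀ b₁, 3 * M ≤ Kerr.radius a (γ t).1 := by
    intro t ht
    by_contra hlt
    push Not at hlt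
    have ht0 : 0 < (γ t : E4) 0 := by
      have := KerrCausal.strictMonoOn_time ordConnected_Icc hγ (left_mem_Icc.2 hb.le)
        ⟨ht.1.le, ht.2⟩ ht.1
      simp only at this
      linarith
    have hγtI : γ t ∈ (Kerr.smoothMetric M a M).chronologicalFuture
        ((Kerr.timeOrientation M a M hM.le).ofLE le_top) (slabK M a) :=
      interior_causalFuture_subset hn1 _ (hcylint ⟨ht0, hlt⟩)
    have hxγt : x ∈ (Kerr.smoothMetric M a M).causalFuture
        ((Kerr.timeOrientation M a M hM.le).ofLE le_top) {γ t} := by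
      rcases ht.2.eq_or_lt with htb | htb
      · rw [← hxb, ← htb]
        exact LorentzianMetric.subset_causalFuture _ _ _ (mem_singleton _)
      · exact Or.inr ⟨γ t, rfl, γ, t, b₁, htb, hγ.mono (Icc_subset_Icc ht.1.le le_rfl), rfl, hxb⟩
    have hxI := LorentzianMetric.mem_chronologicalFuture_of_mem_chronologicalFuture_of_mem_causalFuture_set
      hn1 hγtI hxγt
    exact hxint (interior_maximal (LorentzianMetric.chronologicalFuture_subset_causalFuture _ _ _)
      (LorentzianMetric.isOpen_chronologicalFuture_of_boundaryless _ _ _) hxI)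
  -- by continuity at the start, `r(p) ≥ 3M`, hence `r(p) = 3M`
  have hcont : ContinuousWithinAt (fun t => Kerr.radius a (γ t).1) (Ioc b₀ b₁) b₀ :=
    (KerrCausal.hasDerivAt_radius hγ (left_mem_Icc.2 hb.le)).continuousAt.continuousWithinAt
  haveI : (𝓝[Ioc b₀ b₁] b₀).NeBot := left_nhdsWithin_Ioc_neBot hb
  have hge : 3 * M ≤ Kerr.radius a (γ b₀).1 :=
    ge_of_tendsto hcont (eventually_nhdsWithin_of_forall hfar)
  rw [hpa] at hge
  have hpr' : Kerr.radius a (p : E4) ≤ 3 * M := hpr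
  have hpS : p ∈ outerSphereK M a := ⟨hp0, le_antisymm hpr' hge⟩
  exact Or.inr ⟨p, hpS, γ, b₀, b₁, hb, hγ, hpa, hxb⟩

end KerrSide

end FrontierK

/-- **Registered sub-goal `stub_slabFrontier` (K2b-2, `K2Route.SlabFrontier` from
`K2Route.SlabFutureContainsCylinder`).**  In the Kerr star chart `{r > M}`, `0 < M`, `|a| < M`: the frontier
of `J⁺(slab)`, `slab = {t* = 0, r ≤ 3M}`, lies in `slab ∪ J⁺(S₃)`, `S₃ = {t* = 0, r = 3M}` — a priori
bounds by the causal clocks, closedness of `J⁺(slab)` away from the hole by global hyperbolicity of the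
big lenses, and push-up (`FrontierK.frontier_JK_slabK_subset`). [cite: HawkingEllis1973CUP, §6.3, Prop. 6.3.1] -/
theorem stub_slabFrontier : K2Route.SlabFutureContainsCylinder → K2Route.SlabFrontier := by
  intro hcyl _ M a hM ha
  exact FrontierK.frontier_JK_slabK_subset hM ha (hcyl M a hM ha)

end Summit.FinalStateConjecture.FinalStateConjecture.Theorems.BondiBartnikRigidity.DirectMethod

end
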